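/-
Origin: expansion seat `planner-pub-hodgecm-mc-axioms-1-g12-0`, handover #1 2026-08-20T01:02Z md5 6f2a63ff47691b8b151ec8d778841b21 (264 l.) NEW additive leaf `Literature/AlbaneseUnitaryShimuraCM.lean` — (P-i) CITE RECORD of the `hsmall` twins: [Liu21] Thm 4.15 + Thm 4.18 main + (1) typed AS PRINTED over bare carriers `LiuAlbaneseCMDatum extends LiuAlbaneseDatum` (+ READING `Thm418_viaPullback` = proof map (4.3), separate Prop; + 4 bookkeeping theorems, trio). Imports `Mathlib`, `HodgeCM.Literature.AlbaneseUnitaryShimura` (installed b617965be612) only; nothing imports it; install after `Literature/AlbaneseUnitaryShimura`; drop alone on bounce. CERT: farm rc 0 / 0 warnings / 0 proof-hole / axioms ⊆ trio ×4. (`HOME/mc/pub-hodgecm-mc-axioms-1-g12/lean/pi/HodgeCM/Literature/AlbaneseUnitaryShimuraCM.lean`, md5 6f2a63ff4769, 264 lines);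
landed by the second packager (p2) in gate run 38 as `HodgeCM/Literature/AlbaneseUnitaryShimuraCM.lean` (verbatim).
-/
/-
Copyright (c) 2026 the pub-hodgecm formalisation cell (harness21).  New file, not vendored.
Origin: HOME/mc/pub-hodgecm-mc-axioms-1-g12/lean/pi/HodgeCM/Literature/AlbaneseUnitaryShimuraCM.lean — session
planner-pub-hodgecm-mc-axioms-1-g12-0 (unit pub-hodgecm-mc-axioms-1-g12, CONSTRUCTION PROVER gen 12 of lineage mc-axioms-1,
node N-i1 (L-lvl)), 2026-08-20.  Intended final place: `HodgeCM/Literature/AlbaneseUnitaryShimuraCM.lean` (NEW additive leaf;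
imports `Mathlib` and the landed `HodgeCM.Literature.AlbaneseUnitaryShimura` (runs 20/25, installed md5 b617965be612) only;
no WIP import, no rewrite; nothing imports it).  This is the (P-i) CITE RECORD of the «`hsmall` twins» booked for the run after
GATE RUN 37 (BINDER-OWNERS.md T-MINUS «ROWS 1 / 7 / 9»; BINDER-TRIAGE.md §58 `hsmall` TYPE RULING: P-PENDING → CITE [Liu21],
never a PROVE item).
-/
import Mathlib
import Summits.HodgeConjecture.HodgeCM.Literature.AlbaneseUnitaryShimura

set_option autoImplicit false

/-!
# Cited: CM in the Albanese of unitary Shimura varieties — [Liu21] Thm. 4.15, Def. 4.16, Rem. 4.17, Thm. 4.18 (main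
# statement and item (1))

[Liu21] = Yifeng Liu, *Fourier–Jacobi cycles and arithmetic relative trace formula* (with an appendix by Chao Li and
Yihang Zhu), Cambridge J. Math. **9** (2021), no. 1, 1–147 = arXiv:2102.11518, §4.2 "Albanese of unitary Shimura varieties"
(held extraction `paper:arxiv-2102.11518`, chunks p0022 L1–L66 and p0023 L1–L20; author's TeX source `FJcycle.tex` (arXiv
e-print, dated 2021-06-19) ll. 2151–2185 (`th:cm_albanese_pre`), 2218–2230 (`de:cm_space`, `re:cm_space`), 2232–2268
(`th:cm_albanese` with the first part of its proof), cell-readable copy `HOME/pub-hodgecm-cf-kudla-howe-rallis-g4/lit/Liu21-arxiv-src/`).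
Numbering = the compiled arXiv version ('Theorem 4.15.' p0022 L15, 'Definition 4.16.' p0022 L50, 'Remark 4.17.' p0022 L56,
'Theorem 4.18.' p0022 L59); the Cambridge J. Math. numbering is unconfirmed (acquisition acq-07613 — same caveat as
`AlbaneseUnitaryShimura.lean` and `LiuCMData.lean`).

WHY THIS FILE.  `HodgeCM/Literature/AlbaneseUnitaryShimura.lean` types [Liu21] Prop. 4.13 (`LiuAlbaneseDatum.Prop413`),
Thm. 4.18 (2) (`Thm418_2`) and Cor. 4.20 (`Cor420`) over the bare carriers `LiuAlbaneseDatum`, and RECORDS — in the docstring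
of `Thm418_2`, untyped — Thm. 4.15, Def. 4.16 and Thm. 4.18's main statement with items (1), (3) ("their typed home is the
N05 holder's split of PerL Prop 2.3 over `Universe.Uiso`").  Since GATE RUN 36 the E term of the cell discharges its binder
row 9 `hLiu` ("theta classes lie in the CM-isotypic part `Universe.Uiso`") MODULO exactly one residual hypothesis `hsmall`
(`HodgeCM.Model.hLiu_of_smallLevel`, `Model/HLiuOfSmallLevel.lean`), whose text is the small-level, `K`-ordered shape
"`∀ i, ∃ Γ₀, ∀ Γ ≤ Γ₀, ∃ M k σ', … Theta V c i Γ ⊆ Uiso Γ M (inflate k (c.Ψ i)) σ'`" — by the desk's ruling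
(BINDER-TRIAGE.md §58) a CITATION of [Liu21] Thm. 4.15 + Thm. 4.18 (1) (+ Prop. 4.13), never an internally proved statement.
A citation under the cell's ABSOLUTE RULE is a verbatim, page-referenced quotation of the published theorem; this file is that
quotation, TYPED, for the two statements the landed record left untyped.  The junction from these bare-carrier sentences to
the model's objects (`Universe.ThetaModel.Theta`, `Universe.Uiso`) is NOT made here: it is the content lanes' dictionary
((J-Liu-Θ): theta classes span the `ω(μ,ε,χ)`-isotypic component — the PROOF of Prop. 4.13; (J-Liu-K): `K ↔ Γ`,
`A_K ↔ Alb`, `τ' ↔ σ'`) and the (J-Liu-iso) kernel (common-reflex Hodge morphisms), filed separately.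

DISCIPLINE (as in the lineage's other records).  Bare carriers; each published sentence typed as a `def … : Prop`; a reading
that is NOT a displayed statement of the source is typed as a SEPARATE named `Prop` and labelled READING; nothing is asserted;
no statement of the 2001 programme, of PerL or of [QW8] is used; the few `theorem`s are bookkeeping consequences proved in
the kernel from the named `Prop`s as hypotheses.

AS PRINTED (author's TeX, macros resolved as in `AlbaneseUnitaryShimura.lean` v3: `\bG` = `U(𝕍)` written `G`, `\dQ_\ell^\ac` =
`ℚ_ℓ^{ac}`, `\rH^1_{\rB,\tau'}` = `H¹_{B,τ'}`, `\rH^1_{\et}` = `H¹_{ét}`, `\mu^\alg` = `μ^{alg}`, `\cA(\mu)` = `𝒜(μ)`,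
`\Phi_\mu` = `Φ_μ` the CM type of `μ` (Def. 4.3 (2), ll. 1909–1917), `M_\mu` (ll. 1920–1925): "`μ^{alg} := μ·|·|_E^{−1/2}`, which is
then algebraic. Denote by `M_μ ⊆ ℂ` the subfield generated by values `μ^{alg}(x)` for `x ∈ (𝔸_E^∞)^×`, which is a number field
containing `M'_μ`").

* **The characters `ρ_{τ',ℓ}(μ,ε,χ)`** (ll. 2151–2174; chunk p0022 L1–13).  "Now we study the `ℓ`-adic cohomology of `A_∞`.
  Take an embedding `τ' : E → ℂ`, a rational prime `ℓ`, and an isomorphism `ι_ℓ : ℂ ≅ ℚ_ℓ^{ac}`. We have a canonical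
  isomorphism `H¹_{ét}(A_K ⊗_{E,τ'} ℂ, ℚ_ℓ^{ac}) ≃ H¹_{B,τ'}(A_K, ℂ) ⊗_{ℂ,ι_ℓ} ℚ_ℓ^{ac}` by the comparison theorem. Put
  `H¹_{ét}(A_∞ ⊗_{E,τ'} ℂ, ℚ_ℓ^{ac}) := colim_K H¹_{ét}(A_K ⊗_{E,τ'} ℂ, ℚ_ℓ^{ac})`, which is a
  `ℚ_ℓ^{ac}[Gal(ℂ/τ'(E)) × G(𝔸_F^∞)]`-module.  Suppose that `n ≥ 3` and consider an adèlic oscillator triple `(μ,ε,χ)` in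
  which `μ` is of weight one and `ε` is `μ`-admissible. Then
  `Hom_{ℚ_ℓ^{ac}[G(𝔸_F^∞)]}(ι_ℓ ∘ ω(μ,ε,χ), H¹_{ét}(A_∞ ⊗_{E,τ'} ℂ, ℚ_ℓ^{ac}))` is a representation of `Gal(ℂ/τ'(E))` over
  `ℚ_ℓ^{ac}`. By Proposition 4.13, such representation is an `ℓ`-adic character, denoted by
  `ρ_{τ',ι_ℓ}(μ,ε,χ) : Gal(ℂ/τ'(E)) → (ℚ_ℓ^{ac})^×`. It induces, via the isomorphism `ι_ℓ`, an automorphic character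
  `ρ_{τ',ℓ}(μ,ε,χ) : τ'(E)^× \ 𝔸_{τ'(E)}^× → ℂ^×`. It is easy to see that the character `ρ_{τ',ℓ}(μ,ε,χ)` does not depend on
  the isomorphism of `ι_ℓ`, which justifies its notation."
* **Thm. 4.15** (`th:cm_albanese_pre`, ll. 2177–2185; chunk p0022 L15–20).  "Suppose that `n ≥ 3` and let `(μ,ε,χ)` be an
  adèlic oscillator triple in which `μ` is of weight one and `ε` is `μ`-admissible. Then we have
  `ρ_{τ',ℓ}(μ,ε,χ) ∘ τ' = μ^{alg}` for every `τ' ∈ Φ_μ` and every rational prime `ℓ`."  Proof inputs named there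
  (ll. 2187–2215): the `τ`-nearby hermitian space and `Sh(G,h)` of App. C, `H¹_{(2)}`, theta functions `θ_μ^φ` in the Fock
  model restricted to `Sh(G_⋆,h_⋆)` with `dim V_⋆ = 2`, "[MR92] Proposition 6" (footnote: its proof gives `dim V_⋆ = 2`),
  Remark D.5 / Theorem D.6 (1) of Appendix D "Cohomology of unitary Shimura curves" (`re:galois_curve` l. 5396,
  `th:galois_curve` l. 5433; held extraction 'Remark 10.5.' p0059 L4, 'Theorem 10.6.' p0059 L29 — the extraction numbers the
  appendices A–D as sections 7–10), [MR92] = V. K. Murty, D. Ramakrishnan, *The Albanese of unitary Shimura varieties*, in: The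
  zeta functions of Picard modular surfaces, Montréal 1992, 445–464.
* **Def. 4.16** (`de:cm_space`, ll. 2218–2224; p0022 L50–55).  "Let `μ : E^× \ 𝔸_E^× → ℂ^×` be a conjugate symplectic
  character of weight one. For every object `D_μ = (A_μ, i_μ, λ_μ, r_μ) ∈ 𝒜(μ)` (Definition 4.5), the `ℚ`-vector space
  `Hom_E(A_∞, A_μ)_ℚ` is an `M_μ[G(𝔸_F^∞)]`-module, where `M_μ` acts via `i_μ` and `G(𝔸_F^∞)` acts `M_μ`-linearly via its
  action on `A_∞`. Put `Ω(μ) := colim_{D_μ ∈ 𝒜(μ)} Hom_E(A_∞, A_μ)_ℚ` in the category of `M_μ[G(𝔸_F^∞)]`-modules."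
* **Rem. 4.17** (`re:cm_space`, ll. 2226–2228; p0022 L56–57).  "It follows from Proposition 4.6 (1) that for every object
  `D_μ = (A_μ, i_μ, λ_μ, r_μ) ∈ 𝒜(μ)`, the canonical map `Hom_E(A_∞, A_μ)_ℚ → Ω(μ)` is an isomorphism."
* **Thm. 4.18** (`th:cm_albanese`, ll. 2232–2244; p0022 L59–66).  "There is an isomorphism
  `Ω(μ) ⊗_{M_μ} ℂ ≃ ⊕_ε ⊕_χ ω(μ,ε,χ)` of `ℂ[G(𝔸_F^∞)]`-modules, where the direct sum is taken over all `ε, χ` such that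
  `ε` is `μ`-admissible. Moreover, (1) For every object `D_μ = (A_μ, i_μ, λ_μ, r_μ) ∈ 𝒜(μ)`, we have a canonical isomorphism
  `Ω(μ)^K ≃ Hom_E(A_K, A_μ)_ℚ` for every sufficiently small open compact subgroup `K ⊆ G(𝔸_F^∞)`. (2) The
  `ℂ[G(𝔸_F^∞)]`-modules in the direct sum in Theorem 4.18 are mutually non-isomorphic. (3) For every given `ε` that is
  `μ`-admissible, the subspace `⊕_χ ω(μ,ε,χ)` is stable under the action of `Gal(ℂ/M_μ)`."
* **Thm. 4.18, proof, the map (4.3)** (`eq:cm_albanese`, ll. 2247–2266; p0023 L1–14) — quoted because the junction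
  consumer reads the isomorphism of the theorem AS THIS MAP (READING `Thm418_viaPullback` below, not a displayed statement):
  "Take an arbitrary object `D_μ = (A_μ,i_μ,λ_μ,r_μ) ∈ 𝒜(μ)` and identify `Ω(μ)` with `Hom_E(A_∞,A_μ)_ℚ` by Remark 4.17.
  Take an embedding `τ' : E → ℂ` in `Φ_μ`. It is clear that the maximal subspace of the complex vector space `H¹_{B,τ'}(A_μ, ℂ)`
  over which `M_μ` acts via the inclusion `M_μ ↪ ℂ` has dimension `1`. We choose a basis `α` of this subspace. Then we obtain
  a map `Ω(μ) → H¹_{B,τ'}(A_∞, ℂ)` by pulling back `α`, which is `ℂ[G(𝔸_F^∞)]`-linear. It canonically extends to a map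
  (4.3) `Ω(μ) ⊗_{M_μ} ℂ → H¹_{B,τ'}(A_∞, ℂ)`. … By Faltings' isogeny theorem [Fal83], we have a canonical isomorphism
  `Ω(μ) ⊗_{M_μ,ι_ℓ} ℚ_ℓ^{ac} ≃ Hom_{ℚ_ℓ^{ac}[Gal(ℂ/τ'(E))]}(ℚ_ℓ^{ac}·α, H¹_{ét}(A_μ ⊗_{E,τ'} ℂ, ℚ_ℓ^{ac}))` [so printed, ll. 2261 and
  2265; reader's note, not a correction of the record: the `ℚ_ℓ^{ac}[G(𝔸_F^∞)]`-module structure invoked in the next sentence is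
  that of `H¹_{ét}(A_∞ ⊗_{E,τ'} ℂ, ℚ_ℓ^{ac})`]. However, by Definition 4.5 (2), the action of `Gal(ℂ/τ'(E))` on the line
  `ℚ_ℓ^{ac}·α` spanned by `α` is given by the automorphic character `ι_ℓ ∘ μ^{alg} ∘ (τ')^{−1}`. When `n ≥ 3` (resp. `n = 2`),
  by Proposition 4.13 (resp. Proposition D.4 (1) with Remark D.5) and Theorem 4.15 (resp. Theorem D.6 (1)), we have an
  isomorphism
  `Hom_{ℚ_ℓ^{ac}[Gal(ℂ/τ'(E))]}(ℚ_ℓ^{ac}·α, H¹_{ét}(A_μ ⊗_{E,τ'} ℂ, ℚ_ℓ^{ac})) ≃ ⊕_ε ⊕_χ ω(μ,ε,χ) ⊗_{ℂ,ι_ℓ} ℚ_ℓ^{ac}` of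
  `ℚ_ℓ^{ac}[G(𝔸_F^∞)]`-modules induced by pulling back `α`, where the direct sum is taken over all `ε, χ` such that `ε` is
  `μ`-admissible. Thus, we obtain an isomorphism as in the theorem, which depends only on `α`, not on `ℓ`, `ι_ℓ`, and `τ'`.
  The additional statement (1) follows from the above discussion as well. Statement (2) follows from Lemma D.1
  [`le:weil_nonarch`, l. 5226; extraction 'Lemma 10.1.' p0056 L20]."  ([Fal83] = G. Faltings, *Endlichkeitssätze für abelsche
  Varietäten über Zahlkörpern*, Invent. Math. 73 (1983) 349–366.)

TYPING (what the bare carriers stand for; see `LiuAlbaneseCMDatum`).  Thm. 4.15 is an equality of automorphic characters of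
`E^× \ 𝔸_E^×`: both sides are carried as elements of one bare type `HeckeE` — `muAlg μ = μ^{alg}` and
`rhoTau τ' ℓ μ a = ρ_{τ',ℓ}(μ,ε,χ) ∘ τ'` (the composite with `τ' : E ≅ τ'(E)` is carried whole; for `n < 3` or `τ' ∉ Φ_μ`
the carrier's value is irrelevant, the `Prop` only speaks under the printed hypotheses).  Thm. 4.18's main isomorphism is
typed, like `Prop413`, as the MULTIPLICITY statement for the admissible `ℂ[G(𝔸_F^∞)]`-module `Ω(μ) ⊗_{M_μ} ℂ`: the
multiplicity of an irreducible `ρ` is the number of `μ`-admissible `(ε,χ)` with `ω(μ,ε,χ) ≅ ρ` (this reading USES that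
each `ω(μ,ε,χ)` is irreducible — Def. 4.11, quoted in `AlbaneseUnitaryShimura.lean` — and is then equivalent to the
displayed isomorphism for admissible semisimple modules).  Item (1) is typed as the equality of `ℚ`-dimensions
`dim_ℚ Ω(μ)^K = dim_ℚ Hom_E(A_K, A_μ)_ℚ` (both finite: `(Ω(μ) ⊗_{M_μ} ℂ)^K` is finite-dimensional by admissibility) for
all `K` below a threshold `K₀` in the bare inclusion relation `sub` of levels ("for every sufficiently small open compact
subgroup" = `∃ K₀, ∀ K ⊆ K₀`; the same `K`-order as the cell's `hsmall`, BINDER-TRIAGE.md §57/§60; `Cor420` instead reads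
"sufficiently small" into the carrier `Level` — either reading is the printed one, neither is stronger); the word
"canonical" (= induced by restriction along `A_K → A_∞`, i.e. `Hom_E(A_∞,A_μ)_ℚ^K = Hom_E(A_K,A_μ)_ℚ`) is not typed.
With ONE posited `A_μ` per `μ` (the parent carrier `Amu`, licensed by Prop. 4.6 (1)), Rem. 4.17 identifies `Ω(μ)` with
`Hom_E(A_∞, A_μ)_ℚ`; Def. 4.16 / Rem. 4.17 are therefore recorded, not typed.  NOT TYPED EITHER: item (3) (Galois
stability), the `n = 2` clauses, Def. 4.19 `Ω(μ,ε)`.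
-/

noncomputable section

universe u

namespace HodgeCM.Literature.Theta

/-- **Carriers for [Liu21] Thm. 4.15 / Thm. 4.18**, on top of `LiuAlbaneseDatum` (`Char` = weight-one conjugate-symplectic
automorphic characters `μ` of `𝔸_E^×`; `Adm μ` = the `μ`-admissible `(ε,χ)`; `Rep`, `omega μ a = ω(μ,ε,χ)`; `Emb` = embeddings
`τ' : E → ℂ`; `H1mult τ' ρ` = multiplicity of `ρ` in `H¹_{B,τ'}(A_∞, ℂ)`; `Level`; `Amu μ = [A_μ]`; `n = rank 𝕍`):
* `PhiMu μ τ'` — "`τ' ∈ Φ_μ`", `Φ_μ` the CM type of `μ` (Def. 4.3 (2));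
* `HeckeE` — automorphic characters `E^× \ 𝔸_E^× → ℂ^×` (bare); `muAlg μ` — `μ^{alg} := μ·|·|_E^{−1/2}` (l. 1922);
  `rhoTau τ' ℓ μ a` — `ρ_{τ',ℓ}(μ,ε,χ) ∘ τ'`, the pull-back to `E` along `τ'` of the automorphic character of `τ'(E)`
  attached (for `n ≥ 3`) to the `ℓ`-adic Galois character on `Hom_{G}(ι_ℓ ∘ ω(μ,ε,χ), H¹_{ét}(A_∞ ⊗_{E,τ'} ℂ, ℚ_ℓ^{ac}))`
  (ll. 2151–2174);
* `OmegaMult μ ρ` — the multiplicity of the irreducible `ρ` in the `ℂ[G(𝔸_F^∞)]`-module `Ω(μ) ⊗_{M_μ} ℂ`,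
  `Ω(μ) = Hom_E(A_∞, A_μ)_ℚ` (Def. 4.16 / Rem. 4.17);
* `sub K K'` — the inclusion `K ⊆ K'` of open compact subgroups (bare relation, no order instance);
* `OmegaInvDim μ K` — `dim_ℚ Ω(μ)^K`; `HomDim K μ` — `dim_ℚ Hom_E(A_K, A_μ)_ℚ`;
* `pullMult τ' μ ρ` — for the READING `Thm418_viaPullback` only: the multiplicity of `ρ` in the IMAGE of the map (4.3)
  `Ω(μ) ⊗_{M_μ} ℂ → H¹_{B,τ'}(A_∞, ℂ)`, `f ⊗ z ↦ z · f^*α` (`α` a basis of the line of `H¹_{B,τ'}(A_μ, ℂ)` on which `M_μ`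
  acts through `M_μ ↪ ℂ`), a `ℂ[G(𝔸_F^∞)]`-submodule of `H¹_{B,τ'}(A_∞, ℂ)`. -/
structure LiuAlbaneseCMDatum extends LiuAlbaneseDatum.{u} where
  /-- `τ' ∈ Φ_μ` -/
  PhiMu : Char → Emb → Prop
  /-- automorphic characters of `E^× \ 𝔸_E^×` -/
  HeckeE : Type u
  /-- `μ ↦ μ^{alg}` -/
  muAlg : Char → HeckeE
  /-- `(τ', ℓ, μ, (ε,χ)) ↦ ρ_{τ',ℓ}(μ,ε,χ) ∘ τ'` -/
  rhoTau : Emb → ℕ → (μ : Char) → Adm μ → HeckeE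
  /-- multiplicity of `ρ` in `Ω(μ) ⊗_{M_μ} ℂ` -/
  OmegaMult : Char → Rep → ℕ
  /-- `K ⊆ K'` -/
  sub : Level → Level → Prop
  /-- `dim_ℚ Ω(μ)^K` -/
  OmegaInvDim : Char → Level → ℕ
  /-- `dim_ℚ Hom_E(A_K, A_μ)_ℚ` -/
  HomDim : Level → Char → ℕ
  /-- multiplicity of `ρ` in the image of (4.3) inside `H¹_{B,τ'}(A_∞, ℂ)` -/
  pullMult : Emb → Char → Rep → ℕ

namespace LiuAlbaneseCMDatum

variable (D : LiuAlbaneseCMDatum.{u})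

/-- **[Liu21, Thm. 4.15]** (`FJcycle.tex` ll. 2177–2185; chunk p0022 L15–20), AS PRINTED: "Suppose that `n ≥ 3` and let
`(μ,ε,χ)` be an adèlic oscillator triple in which `μ` is of weight one and `ε` is `μ`-admissible. Then we have
`ρ_{τ',ℓ}(μ,ε,χ) ∘ τ' = μ^{alg}` for every `τ' ∈ Φ_μ` and every rational prime `ℓ`."
TYPING: weight one and `μ`-admissibility are the carriers `Char`, `Adm μ`; the equality is in the bare type `HeckeE` of
automorphic characters of `E^× \ 𝔸_E^×`.  [cite: Liu21, Thm. 4.15] -/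
def Thm415 : Prop :=
  3 ≤ D.n → ∀ (μ : D.Char) (a : D.Adm μ) (τ' : D.Emb), D.PhiMu μ τ' →
    ∀ ℓ : ℕ, ℓ.Prime → D.rhoTau τ' ℓ μ a = D.muAlg μ

/-- **[Liu21, Thm. 4.18, main statement]** (`FJcycle.tex` ll. 2232–2237; chunk p0022 L59–61), AS PRINTED: "There is an
isomorphism `Ω(μ) ⊗_{M_μ} ℂ ≃ ⊕_ε ⊕_χ ω(μ,ε,χ)` of `ℂ[G(𝔸_F^∞)]`-modules, where the direct sum is taken over all `ε, χ`
such that `ε` is `μ`-admissible."  (`Ω(μ) := colim_{D_μ ∈ 𝒜(μ)} Hom_E(A_∞, A_μ)_ℚ`, Def. 4.16; `= Hom_E(A_∞, A_μ)_ℚ` for any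
one object, Rem. 4.17.)
TYPING: as the MULTIPLICITY statement (cf. `LiuAlbaneseDatum.Prop413`): the multiplicity of an irreducible `ρ` in
`Ω(μ) ⊗_{M_μ} ℂ` is the number of `μ`-admissible `a = (ε,χ)` with `ω(μ,a) ≅ ρ` (`Nat.card`; that set is a singleton or
empty by item (2) = `LiuAlbaneseDatum.Thm418_2`); uses the irreducibility of `ω(μ,ε,χ)` (Def. 4.11).  No `n ≥ 3` hypothesis
is printed (for `n = 2` the proof cites Prop. D.4 / Thm. D.6 (1) of Appendix D instead of Prop. 4.13 / Thm. 4.15).  [cite: Liu21, Thm. 4.18] -/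
def Thm418 : Prop :=
  ∀ (μ : D.Char) (ρ : D.Rep), D.OmegaMult μ ρ = Nat.card {a : D.Adm μ // D.omega μ a = ρ}

/-- **[Liu21, Thm. 4.18 (1)]** (`FJcycle.tex` ll. 2238–2239; chunk p0022 L62–63), AS PRINTED: "For every object
`D_μ = (A_μ, i_μ, λ_μ, r_μ) ∈ 𝒜(μ)`, we have a canonical isomorphism `Ω(μ)^K ≃ Hom_E(A_K, A_μ)_ℚ` for every sufficiently
small open compact subgroup `K ⊆ G(𝔸_F^∞)`."
TYPING: `dim_ℚ Ω(μ)^K = dim_ℚ Hom_E(A_K, A_μ)_ℚ` for all `K` with `K ⊆ K₀(μ)` in the bare inclusion relation `sub`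
("sufficiently small" = `∃ K₀, ∀ K ⊆ K₀`); one posited `A_μ` per `μ` (parent carrier `Amu`); "canonical" is not typed.
[cite: Liu21, Thm. 4.18 (1)] -/
def Thm418_1 : Prop :=
  ∀ μ : D.Char, ∃ K₀ : D.Level, ∀ K : D.Level, D.sub K K₀ → D.OmegaInvDim μ K = D.HomDim K μ

/-- **READING — NOT a displayed statement of [Liu21]: Thm. 4.18 read as the map (4.3) of its proof** (`eq:cm_albanese`,
`FJcycle.tex` ll. 2247–2266; chunk p0023 L1–14, quoted in the module docstring): for `τ' ∈ Φ_μ` and `α` a basis of the line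
of `H¹_{B,τ'}(A_μ, ℂ)` on which `M_μ` acts through `M_μ ↪ ℂ`, the `ℂ[G(𝔸_F^∞)]`-linear map
`Ω(μ) ⊗_{M_μ} ℂ → H¹_{B,τ'}(A_∞, ℂ)`, `f ⊗ z ↦ z · f^*α` ("by pulling back `α`") is injective with image isomorphic to
`⊕_ε ⊕_χ ω(μ,ε,χ)` — the proof's sentence "we have an isomorphism … induced by pulling back `α` … Thus, we obtain an
isomorphism as in the theorem, which depends only on `α`, not on `ℓ`, `ι_ℓ`, and `τ'`" (via Faltings [Fal83], Def. 4.5 (2),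
Prop. 4.13 and Thm. 4.15 for `n ≥ 3`).
TYPING: the multiplicity of an irreducible `ρ` in the IMAGE of (4.3) (carrier `pullMult τ' μ ρ`) is the number of
`μ`-admissible `a` with `ω(μ,a) ≅ ρ`.  This is the form in which the cell's residual hypothesis `hsmall` ("theta classes of
datum `i` at small level lie in `Uiso Γ M (inflate k Ψ_i) σ'` = the span of pull-backs, along morphisms to a CM abelian
variety of the induced type, of its `σ'`-eigenline") consumes Thm. 4.18; whether this proof-form sentence is citable print or
only the displayed isomorphism is, is the desk's ruling (BINDER-TRIAGE.md §58), which is why it is a separate `Prop`. -/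
def Thm418_viaPullback : Prop :=
  ∀ (μ : D.Char) (τ' : D.Emb), D.PhiMu μ τ' →
    ∀ ρ : D.Rep, D.pullMult τ' μ ρ = Nat.card {a : D.Adm μ // D.omega μ a = ρ}

variable {D}

/-- Bookkeeping: under item (2) (`Thm418_2`: `(ε,χ) ↦ ω(μ,ε,χ)` injective on `μ`-admissible pairs) the index set
`{a // ω(μ,a) ≅ ω(μ,a₀)}` is the singleton `{a₀}`. -/
theorem card_fibre_omega_eq_one (h2 : D.Thm418_2) (μ : D.Char) (a₀ : D.Adm μ) :
    Nat.card {a : D.Adm μ // D.omega μ a = D.omega μ a₀} = 1 := by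
  rw [Nat.card_eq_one_iff_unique]
  exact ⟨⟨fun x y => Subtype.ext (h2 μ x.1 y.1 (x.2.trans y.2.symm))⟩, ⟨⟨a₀, rfl⟩⟩⟩

/-- **Kernel-checked consequence of Thm. 4.18 (main) + (2): `Ω(μ) ⊗_{M_μ} ℂ` is multiplicity-free and contains each
`ω(μ,ε,χ)` exactly once.** -/
theorem Thm418.omegaMult_omega (h : D.Thm418) (h2 : D.Thm418_2) (μ : D.Char) (a : D.Adm μ) :
    D.OmegaMult μ (D.omega μ a) = 1 := by
  rw [h μ (D.omega μ a)]
  exact card_fibre_omega_eq_one h2 μ a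

/-- (Ported verbatim from the HodgeCMPerL package; no docstring in the source.) -/
theorem Thm418.omegaMult_le_one (h : D.Thm418) (h2 : D.Thm418_2) (μ : D.Char) (ρ : D.Rep) :
    D.OmegaMult μ ρ ≤ 1 := by
  rw [h μ ρ]
  haveI : Subsingleton {a : D.Adm μ // D.omega μ a = ρ} :=
    ⟨fun x y => Subtype.ext (h2 μ x.1 y.1 (x.2.trans y.2.symm))⟩
  exact Finite.card_le_one_iff_subsingleton.mpr inferInstance

/-- **Kernel-checked consequence of the READING (4.3) with Prop. 4.13 and Thm. 4.18 (2), `n ≥ 3`: for `τ' ∈ Φ_μ` the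
summand `ω(μ,ε,χ)` occurs in the image of "pulling back `α`" with the SAME multiplicity, one, as in the whole of
`H¹_{B,τ'}(A_∞, ℂ)`** — so (admissible modules being semisimple) the `ω(μ,ε,χ)`-isotypic component of `H¹_{B,τ'}(A_∞, ℂ)` IS
spanned by the pull-backs `f^*α`, `f ∈ Hom_E(A_∞, A_μ)_ℚ`: the numerical shadow of the cell's `hsmall`.  The separation
hypothesis `hμ` (distinct `μ` give non-isomorphic oscillator representations — true through the central characters, not
printed as such) is explicit, as in `LiuAlbaneseDatum.Prop413.mult_le_one`. -/
theorem Thm418_viaPullback.pullMult_eq_H1mult (h : D.Thm418_viaPullback) (h413 : D.Prop413) (h2 : D.Thm418_2)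
    (hn : 3 ≤ D.n) (hμ : ∀ (μ μ' : D.Char) (a : D.Adm μ) (b : D.Adm μ'), D.omega μ a = D.omega μ' b → μ = μ')
    {μ : D.Char} {τ' : D.Emb} (hτ' : D.PhiMu μ τ') (a : D.Adm μ) :
    D.pullMult τ' μ (D.omega μ a) = 1 ∧ D.H1mult τ' (D.omega μ a) = 1 := by
  refine ⟨?_, ?_⟩
  · rw [h μ τ' hτ' (D.omega μ a)]
    exact card_fibre_omega_eq_one h2 μ a
  · rw [h413 hn τ' (D.omega μ a), Nat.card_eq_one_iff_unique]
    refine ⟨⟨fun x y => Subtype.ext ?_⟩, ⟨⟨⟨μ, a⟩, rfl⟩⟩⟩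
    obtain ⟨⟨μ₁, a₁⟩, hx⟩ := x
    obtain ⟨⟨μ₂, a₂⟩, hy⟩ := y
    have h12 : μ₁ = μ₂ := hμ μ₁ μ₂ a₁ a₂ (hx.trans hy.symm)
    subst h12
    have ha : a₁ = a₂ := h2 μ₁ a₁ a₂ (hx.trans hy.symm)
    subst ha
    rfl

end LiuAlbaneseCMDatum

end HodgeCM.Literature.Theta

end
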